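import Literature.AlgebraicGeometry.Morphisms.ClosedImmersionOfInfinitesimalFactorisations
import Literature.AlgebraicGeometry.AbelianSchemes.RigidifiedLineBundleComap
import Literature.AlgebraicGeometry.AbelianVarieties.PoincareSheafOfPrincipal
import Literature.AlgebraicGeometry.Modules.QuasicoherentAbelian
import Literature.AlgebraicGeometry.Modules.AffineLocalizing
import HarnessLib

/-!
# From the seesaw closed subscheme and infinitesimal triviality to «pulled back from the base» (Mumford §10 + Krull)

Layer `Literature/AlgebraicGeometry/Motives`, namespace `Literature.AlgebraicGeometry.Motives`.  THEOREMS ONLY (no definition, no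
named fact, no instance, no notation).  Cell `hodgecm-mathlib` (D-0151), F-2d road (R-def) «theorem of the cube over a NON-reduced
base», brick D5c-β (author B-p07 (g16)): the assembly step that replaces Step (II) of [GortzWedhorn2023] Lemma 24.72.

Data: a family `X ⊗ W → W` of `R`-schemes (`X W : SchemeOver R`, `W` locally noetherian), a module `N` on `X ⊗ W`, and a SEESAW
CLOSED SUBSCHEME `i : Z ↪ W` for `N` — universal for «`N|_{X ⊗ S}` is pulled back from `S`» (the conclusion of ★/in-flight
`SeesawRelative.exists_seesawSubscheme`, [MumfordAV1970] §10, taken here as a HYPOTHESIS `huniv` so that this file does not depend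
on it).  If `N` is trivial on `X ⊗ Spec(𝒪_{W,t}/𝔪_t^{n+1})` for every point `t` of `W` and every `n` (the conclusion of Step (I), ★
`Motives/CubeStepIRing.cubeStepI_localRing`, transported), then every infinitesimal neighbourhood of every point factors through
`Z` (universality with `𝓜 = 𝒪`), so `Z = W` by Krull (★ D3″ `IsClosedImmersion.isIso_of_forall_infinitesimal_factors`), and
universality at `𝟙_W` gives `N ≅ pr_W^* 𝓜` for a rank-one `𝓜` on `W`.

* (private) `exists_fac_of_trivial` — universality with `𝓜 = 𝒪` factors a test morphism through `Z`;
* **`exists_iso_pullback_snd_of_seesaw_of_infinitesimal`** — the statement above.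

HC_CM is proved only modulo the 7 printed citations until rung 0 closes; nothing here is about HC.

## References
* [MumfordAV1970] D. Mumford, *Abelian Varieties* (1970), §10, seesaw theorem (the maximal closed subscheme), §6 (cube).
* [GortzWedhorn2023] U. Görtz, T. Wedhorn, *Algebraic Geometry II* (2023), Lemma 24.72 proof Step (II) (p. 409) (replaced here).
* [AtiyahMacdonald1969] M. Atiyah, I. Macdonald, *Introduction to Commutative Algebra* (1969), Cor. 10.20 (Krull, via ★ D3″).
-/

noncomputable section

universe u

open CategoryTheory CategoryTheory.Limits AlgebraicGeometry MonoidalCategory CartesianMonoidalCategory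
open IsLocalRing
open Literature.AlgebraicGeometry.Morphisms Literature.AlgebraicGeometry.Modules
open Literature.AlgebraicGeometry.AbelianSchemes.AbelianSchemeOver
open Literature.AlgebraicGeometry.AbelianVarieties

namespace Literature.AlgebraicGeometry.Motives

/-- The factorisation step (private, with the test scheme as a variable to keep instance search small): if `N` is trivial on
`X ⊗ T` for an `R`-morphism `g : T → W`, universality of the seesaw subscheme with `𝓜 = 𝒪_T` factors `g` through `Z`. [folklore] -/
private theorem exists_fac_of_trivial {R : Type u} [CommRing R] (X W : SchemeOver R) (N : (X ⊗ W).left.Modules)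
    {Z : SchemeOver R} (i : Z ⟶ W)
    (huniv : ∀ (S : SchemeOver R) (u : S ⟶ W), (∃ v : S ⟶ Z, v ≫ i = u) ↔
      ∃ (𝓜 : S.left.Modules) (_ : 𝓜.IsQuasicoherent) (_ : HasRank 𝓜 1),
        Nonempty ((Scheme.Modules.pullback (X ◁ u).left).obj N ≅ (Scheme.Modules.pullback (snd X S).left).obj 𝓜))
    {T : Scheme.{u}} (g : T ⟶ W.left)
    (hT : Nonempty (unitModule (X ⊗ Over.mk (g ≫ W.hom)).left ≅
      (Scheme.Modules.pullback (X ◁ (Over.homMk g rfl : Over.mk (g ≫ W.hom) ⟶ W)).left).obj N)) :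
    ∃ v : T ⟶ Z.left, v ≫ i.left = g := by
  obtain ⟨ψ⟩ := hT
  have hq : (unitModule T).IsQuasicoherent := isQuasicoherent_of_isAffineLocalizing IsAffineLocalizing.unit
  obtain ⟨v, hv⟩ := (huniv (Over.mk (g ≫ W.hom)) (Over.homMk g rfl)).2
    ⟨unitModule T, hq, hasRank_unitModule,
      ⟨ψ.symm ≪≫ (RigidifiedLineBundle.pullbackUnitIso (snd X (Over.mk (g ≫ W.hom))).left).symm⟩⟩
  refine ⟨v.left, ?_⟩
  have hl := congrArg (fun φ => φ.left) hv
  simp only [Over.comp_left, Over.homMk_left] at hl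
  exact hl

/-- **SEESAW + KRULL ⟹ PULLED BACK FROM THE BASE** ([MumfordAV1970] §10 with Krull's intersection theorem in place of
[GortzWedhorn2023] Lemma 24.72 Step (II)): for `X W : SchemeOver R` with `W` locally noetherian, a module `N` on `X ⊗ W`, a closed
`R`-subscheme `i : Z ↪ W` universal for «`(X ◁ u)^*N ≅ pr^*𝓜` with `𝓜` quasi-coherent of rank one» (`huniv`), and `N` trivial on
`X ⊗ Spec(𝒪_{W,t}/𝔪_t^{n+1})` for all points `t` of `W` and all `n` (`h`, stated for any `g` equal to the infinitesimal
neighbourhood so that consumers may `subst`): `N ≅ pr_W^*𝓜` for a quasi-coherent rank-one `𝓜` on `W`.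
[cite: MumfordAV1970, §10 (seesaw theorem, the closed subscheme)] [cite: GortzWedhorn2023, Lemma 24.72 proof Step (II) (p. 409)] -/
theorem exists_iso_pullback_snd_of_seesaw_of_infinitesimal {R : Type u} [CommRing R] (X W : SchemeOver R)
    [IsLocallyNoetherian W.left] (N : (X ⊗ W).left.Modules) {Z : SchemeOver R} (i : Z ⟶ W) [IsClosedImmersion i.left]
    (huniv : ∀ (S : SchemeOver R) (u : S ⟶ W), (∃ v : S ⟶ Z, v ≫ i = u) ↔
      ∃ (𝓜 : S.left.Modules) (_ : 𝓜.IsQuasicoherent) (_ : HasRank 𝓜 1),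
        Nonempty ((Scheme.Modules.pullback (X ◁ u).left).obj N ≅ (Scheme.Modules.pullback (snd X S).left).obj 𝓜))
    (h : ∀ (t : W.left) (n : ℕ)
      (g : Spec (.of (↑(W.left.presheaf.stalk t) ⧸ maximalIdeal (W.left.presheaf.stalk t) ^ (n + 1))) ⟶ W.left),
      g = Spec.map (CommRingCat.ofHom (Ideal.Quotient.mk (maximalIdeal (W.left.presheaf.stalk t) ^ (n + 1)))) ≫
        W.left.fromSpecStalk t →
      Nonempty (unitModule (X ⊗ Over.mk (g ≫ W.hom)).left ≅
        (Scheme.Modules.pullback (X ◁ (Over.homMk g rfl : Over.mk (g ≫ W.hom) ⟶ W)).left).obj N)) :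
    ∃ (𝓜 : W.left.Modules) (_ : 𝓜.IsQuasicoherent) (_ : HasRank 𝓜 1),
      Nonempty (N ≅ (Scheme.Modules.pullback (snd X W).left).obj 𝓜) := by
  -- (1) every infinitesimal neighbourhood of every point factors through `Z`: `i.left` is an isomorphism (★ D3″)
  haveI : IsIso i.left :=
    IsClosedImmersion.isIso_of_forall_infinitesimal_factors i.left fun t n =>
      exists_fac_of_trivial X W N i huniv _ (h t n _ rfl)
  -- (2) `i` is an isomorphism of `R`-schemes; universality at `𝟙_W`
  haveI : IsIso ((Over.forget (Spec (CommRingCat.of R))).map i) := ‹IsIso i.left›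
  haveI : IsIso i := isIso_of_reflects_iso i (Over.forget _)
  obtain ⟨𝓜, hq, hr, ⟨e⟩⟩ := (huniv W (𝟙 W)).1 ⟨inv i, IsIso.inv_hom_id i⟩
  have e0 : (X ◁ 𝟙 W).left = 𝟙 (X ⊗ W).left := by rw [MonoidalCategory.whiskerLeft_id]; rfl
  exact ⟨𝓜, hq, hr, ⟨((Scheme.Modules.pullbackId _).app N).symm ≪≫ ((Scheme.Modules.pullbackCongr e0).app N).symm ≪≫ e⟩⟩

end Literature.AlgebraicGeometry.Motives

end
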